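import Mathlib
import Summits.ResolutionOfSingularities.ResolutionOfSingularities.Theorems.HomologicalConductorPersistenceCusp34Separation
import Summits.ResolutionOfSingularities.ResolutionOfSingularities.Theorems.HomologicalConductorPersistenceCusp34Normalisation
import Literature.AlgebraicGeometry.Resolution.MvPowerSeriesNested

/-!
# K-C3 §H2L piece K2b, brick 3 (W4.4b): the kernel of the normalisation of `z³ + t⁴` (nested form)

[OURS · L1 w44b] Work in `k⟦t⟧⟦z⟧ = PowerSeries (PowerSeries k)`.  For ANY ring homomorphism
`ψ : k⟦t⟧⟦z⟧ →+* k⟦s⟧` with `ψ(C a) = a(s³)` and `ψ(z) = -s⁴` (the normalisation; its construction from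
`MvPowerSeries.substAlgHom` / the nested equivalence is a separate plumbing brick), `ψ(g) = 0` for `g = z³ + t⁴` and
**every `F` with `ψ F = 0` lies in `(g)`**: Weierstrass division by the distinguished polynomial `g`
(Mathlib `IsWeierstrassDivisorAt`, `t`-adically complete coefficients) leaves a remainder of degree `< 3`, which vanishes by
the residue separation lemma (brick 2, `expand_three_separation`).  NOT a statement of the manuscript under review.
-/

set_option linter.dupNamespace false

noncomputable section

open PowerSeries

namespace Summit.ResolutionOfSingularities.ResolutionOfSingularities.Theorems.HomologicalConductor.Cusp34

universe u

variable (k : Type u) [Field k]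

/-- The distinguished polynomial `g = z³ + t⁴ ∈ k⟦t⟧⟦z⟧`. [OURS] -/
def gCusp : PowerSeries (PowerSeries k) := X ^ 3 + C ((X : PowerSeries k) ^ 4)

/-- Modulo `t`, `g` becomes `z³`. [OURS] -/
theorem map_gCusp_mod :
    (gCusp k).map (Ideal.Quotient.mk (Ideal.span {(X : PowerSeries k)})) = X ^ 3 := by
  rw [gCusp, map_add, map_pow, map_X, map_C]
  have : (Ideal.Quotient.mk (Ideal.span {(X : PowerSeries k)})) ((X : PowerSeries k) ^ 4) = 0 := by
    rw [Ideal.Quotient.eq_zero_iff_mem]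
    exact Ideal.pow_mem_of_mem _ (Ideal.mem_span_singleton_self _) 4 (by norm_num)
  rw [this, map_zero, add_zero]

/-- `k⟦t⟧/(t)` is nontrivial. [OURS] -/
theorem nontrivial_quot_X : Nontrivial (PowerSeries k ⧸ Ideal.span {(X : PowerSeries k)}) := by
  rw [Ideal.Quotient.nontrivial_iff]
  refine Ideal.span_singleton_ne_top fun h => ?_
  have := isUnit_constantCoeff _ h
  rw [constantCoeff_X] at this
  exact not_isUnit_zero this

/-- The order of `g mod t` is `3`. [OURS] -/
theorem order_map_gCusp_toNat :
    ((gCusp k).map (Ideal.Quotient.mk (Ideal.span {(X : PowerSeries k)}))).order.toNat = 3 := by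
  haveI := nontrivial_quot_X k
  rw [map_gCusp_mod, order_X_pow]
  rfl

/-- `g` is a Weierstrass divisor for the `t`-adic topology (its `z³`-coefficient is `1`). [OURS] -/
theorem isWeierstrassDivisorAt_gCusp :
    (gCusp k).IsWeierstrassDivisorAt (Ideal.span {(X : PowerSeries k)}) := by
  rw [IsWeierstrassDivisorAt, order_map_gCusp_toNat, gCusp, map_add, coeff_X_pow, coeff_C]
  simp

variable {k}
variable (ψ : PowerSeries (PowerSeries k) →+* PowerSeries k)
  (hC : ∀ a : PowerSeries k, ψ (C a) = expand 3 (by norm_num) a) (hX : ψ X = -(X : PowerSeries k) ^ 4)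
include hC hX

/-- `ψ(g) = -s¹² + s¹² = 0`. [OURS] -/
theorem psi_gCusp : ψ (gCusp k) = 0 := by
  rw [gCusp, map_add, map_pow, hX, hC, map_pow, expand_X]
  ring

/-- `ψ` of (the coercion of) a polynomial of `natDegree < 3` in `z`: the three-term formula. [OURS] -/
theorem psi_coe_of_natDegree_lt (r : Polynomial (PowerSeries k)) (hr : r.natDegree < 3) :
    ψ (r : PowerSeries (PowerSeries k)) =
      expand 3 (by norm_num) (r.coeff 0) - X ^ 4 * expand 3 (by norm_num) (r.coeff 1)
        + X ^ 8 * expand 3 (by norm_num) (r.coeff 2) := by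
  have hsum : r = Polynomial.C (r.coeff 0) + Polynomial.C (r.coeff 1) * Polynomial.X
      + Polynomial.C (r.coeff 2) * Polynomial.X ^ 2 := by
    conv_lhs => rw [r.as_sum_range_C_mul_X_pow' hr]
    simp [Finset.sum_range_succ]
  conv_lhs => rw [hsum]
  simp only [Polynomial.coe_add, Polynomial.coe_mul, Polynomial.coe_C, Polynomial.coe_X, Polynomial.coe_pow,
    map_add, map_mul, map_pow, hC, hX]
  ring

/-- **KERNEL.** If `ψ(F) = 0` then `F ∈ (g)`: Weierstrass division by `g` in `k⟦t⟧⟦z⟧` (t-adically complete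
coefficients) plus residue separation. [OURS] -/
theorem mem_span_gCusp_of_psi_eq_zero (F : PowerSeries (PowerSeries k)) (hF : ψ F = 0) :
    F ∈ Ideal.span {gCusp k} := by
  have H := isWeierstrassDivisorAt_gCusp k
  obtain ⟨hdeg, heq⟩ := H.isWeierstrassDivisionAt_div_mod F
  rw [order_map_gCusp_toNat] at hdeg
  set r := H.mod F with hrdef
  have hr' : r.natDegree < 3 := by
    rcases eq_or_ne r 0 with h0 | h0
    · rw [h0]; simp
    · have := hdeg
      rw [Polynomial.degree_eq_natDegree h0] at this
      exact_mod_cast this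
  have hr0 : ψ (r : PowerSeries (PowerSeries k)) = 0 := by
    have := congrArg ψ heq
    rw [map_add, map_mul, psi_gCusp ψ hC hX, zero_mul, zero_add, hF] at this
    exact this.symm
  rw [psi_coe_of_natDegree_lt ψ hC hX r hr'] at hr0
  obtain ⟨h0, h1, h2⟩ := expand_three_separation _ _ _ hr0
  have hr : r = 0 := by
    rw [r.as_sum_range_C_mul_X_pow' hr']
    simp [Finset.sum_range_succ, h0, h1, h2]
  rw [heq, hr, Polynomial.coe_zero, add_zero]
  exact Ideal.mul_mem_right _ _ (Ideal.mem_span_singleton_self _)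

/-- Hence `ker ψ = (g)`. [OURS] -/
theorem psi_eq_zero_iff (F : PowerSeries (PowerSeries k)) : ψ F = 0 ↔ F ∈ Ideal.span {gCusp k} := by
  refine ⟨mem_span_gCusp_of_psi_eq_zero ψ hC hX F, fun h => ?_⟩
  rw [Ideal.mem_span_singleton] at h
  obtain ⟨G, rfl⟩ := h
  rw [map_mul, psi_gCusp ψ hC hX, zero_mul]


/-! ### Transport to `k⟦z,t⟧ = MvPowerSeries (Fin 2) k` and the normalisation `normHom` of brick 1 -/

section FinTwo

omit hC hX

open Literature.AlgebraicGeometry.Resolution.MvPowerSeriesNested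

variable (k)

/-- `Unit ⊕ Unit ≃ Fin 2`, `inl ↦ 0` (the variable `z`), `inr ↦ 1` (the variable `t`). [OURS] -/
def sumUnitEquivFinTwo : Unit ⊕ Unit ≃ Fin 2 where
  toFun := Sum.elim (fun _ => 0) (fun _ => 1)
  invFun i := if i = 0 then Sum.inl () else Sum.inr ()
  left_inv x := by rcases x with ⟨⟨⟩⟩ | ⟨⟨⟩⟩ <;> simp
  right_inv i := by fin_cases i <;> simp

/-- `E : k⟦z,t⟧ ≃+* k⟦t⟧⟦z⟧` (rename `Fin 2 ≃ Unit ⊕ Unit`, then nest). [OURS] -/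
def nestE : MvPowerSeries (Fin 2) k ≃+* PowerSeries (PowerSeries k) :=
  (MvPowerSeries.renameEquiv k (sumUnitEquivFinTwo).symm).toRingEquiv.trans (nestedEquiv Unit Unit k)

/-- Unfolding `E`. [OURS] -/
theorem nestE_apply (F : MvPowerSeries (Fin 2) k) :
    nestE k F = nestedEquiv Unit Unit k (MvPowerSeries.rename (sumUnitEquivFinTwo).symm F) := rfl

/-- Unfolding `E⁻¹`. [OURS] -/
theorem nestE_symm_apply (G : PowerSeries (PowerSeries k)) :
    (nestE k).symm G = MvPowerSeries.rename sumUnitEquivFinTwo ((nestedEquiv Unit Unit k).symm G) := rfl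

/-- `E(z) = z`. [OURS] -/
theorem nestE_X_zero : nestE k (MvPowerSeries.X 0) = (X : PowerSeries (PowerSeries k)) := by
  rw [nestE_apply, MvPowerSeries.rename_X]
  exact nestedEquiv_X_inl ()

/-- `E(t) = C t`. [OURS] -/
theorem nestE_X_one : nestE k (MvPowerSeries.X 1) = C (X : PowerSeries k) := by
  rw [nestE_apply, MvPowerSeries.rename_X]
  exact nestedEquiv_X_inr ()

/-- `E(z³ + t⁴) = g`. [OURS] -/
theorem nestE_cusp34 : nestE k (MvPowerSeries.X 0 ^ 3 + MvPowerSeries.X 1 ^ 4) = gCusp k := by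
  rw [map_add, map_pow, map_pow, nestE_X_zero, nestE_X_one, ← map_pow, gCusp]

/-- `E⁻¹(C a)` is `a` in the variable `t`, i.e. the renaming of `a` along `() ↦ 1`. [OURS] -/
theorem nestE_symm_C (a : PowerSeries k) :
    (nestE k).symm (C a) = MvPowerSeries.rename (sumUnitEquivFinTwo ∘ Sum.inr) a := by
  have h1 : (nestedEquiv Unit Unit k).symm (C a) = inrHom Unit Unit k a := rfl
  rw [nestE_symm_apply, h1, inrHom_eq_rename, MvPowerSeries.rename_rename]

/-- The normalisation in nested coordinates: `ψ = ν ∘ E⁻¹ : k⟦t⟧⟦z⟧ → k⟦s⟧`. [OURS] -/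
def psiHom : PowerSeries (PowerSeries k) →+* PowerSeries k :=
  (normHom k).toRingHom.comp (nestE k).symm.toRingHom

/-- Unfolding `ψ`. [OURS] -/
theorem psiHom_apply (G : PowerSeries (PowerSeries k)) : psiHom k G = normHom k ((nestE k).symm G) := rfl

/-- `ψ(z) = -s⁴`. [OURS] -/
theorem psiHom_X : psiHom k X = -(X : PowerSeries k) ^ 4 := by
  rw [psiHom_apply, ← nestE_X_zero, RingEquiv.symm_apply_apply, normHom_X_zero]

/-- `ψ(C a) = a(s³)`. [OURS] -/
theorem psiHom_C (a : PowerSeries k) : psiHom k (C a) = expand 3 (by norm_num) a := by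
  rw [psiHom_apply, nestE_symm_C, MvPowerSeries.rename_eq_subst, normHom, MvPowerSeries.coe_substAlgHom,
    MvPowerSeries.subst_comp_subst_apply (MvPowerSeries.HasSubst.X_comp _) (hasSubst_normImg k),
    expand_apply, PowerSeries.subst]
  congr 1
  funext u
  rw [Function.comp_apply, MvPowerSeries.subst_X (hasSubst_normImg k)]
  simp [normImg, sumUnitEquivFinTwo]

/-- **`ker ν = (z³ + t⁴)`**: `ν F = 0 ↔ F ∈ (z³ + t⁴)`. [OURS] -/
theorem normHom_eq_zero_iff (F : MvPowerSeries (Fin 2) k) :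
    normHom k F = 0 ↔ F ∈ Ideal.span {(MvPowerSeries.X 0 ^ 3 + MvPowerSeries.X 1 ^ 4 : MvPowerSeries (Fin 2) k)} := by
  have hψ : normHom k F = psiHom k (nestE k F) := by
    rw [psiHom_apply, RingEquiv.symm_apply_apply]
  rw [hψ, psi_eq_zero_iff (psiHom k) (psiHom_C k) (psiHom_X k), ← nestE_cusp34, Ideal.mem_span_singleton,
    Ideal.mem_span_singleton]
  constructor
  · rintro ⟨G, hG⟩
    refine ⟨(nestE k).symm G, ?_⟩
    apply (nestE k).injective
    rw [hG, map_mul, RingEquiv.apply_symm_apply]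
  · rintro ⟨G, rfl⟩
    exact ⟨nestE k G, by rw [map_mul]⟩

/-- `ker ν = (z³ + t⁴)` as an equality of ideals. [OURS] -/
theorem ker_normHom :
    RingHom.ker (normHom k).toRingHom =
      Ideal.span {(MvPowerSeries.X 0 ^ 3 + MvPowerSeries.X 1 ^ 4 : MvPowerSeries (Fin 2) k)} := by
  ext F
  rw [RingHom.mem_ker]
  exact normHom_eq_zero_iff k F

/-- The induced map `ν̄ : k⟦z,t⟧/(z³+t⁴) → k⟦s⟧` is injective. [OURS] -/
theorem normQuotHom_injective : Function.Injective (normQuotHom k) := by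
  rw [normQuotHom, Ideal.injective_lift_iff]
  exact ker_normHom k

/-- **`k⟦z,t⟧/(z³ + t⁴)` is reduced** (it embeds into the domain `k⟦s⟧`); 011's target (i). [OURS] -/
theorem isReduced_cusp34 :
    IsReduced (MvPowerSeries (Fin 2) k ⧸
      Ideal.span {(MvPowerSeries.X 0 ^ 3 + MvPowerSeries.X 1 ^ 4 : MvPowerSeries (Fin 2) k)}) :=
  isReduced_of_injective (normQuotHom k) (normQuotHom_injective k)

/-- … indeed a domain. [OURS] -/
theorem isDomain_cusp34 :
    IsDomain (MvPowerSeries (Fin 2) k ⧸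
      Ideal.span {(MvPowerSeries.X 0 ^ 3 + MvPowerSeries.X 1 ^ 4 : MvPowerSeries (Fin 2) k)}) :=
  Function.Injective.isDomain _ (normQuotHom_injective k)

end FinTwo

end Summit.ResolutionOfSingularities.ResolutionOfSingularities.Theorems.HomologicalConductor.Cusp34

end
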